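import Mathlib
import HarnessLib
import Summits.HubbardSuperconductivity.HubbardSuperconductivity.Theorems.KLProgrammeKLRegimeTwoVolumeTowerCovStepDecay
import Summits.HubbardSuperconductivity.HubbardSuperconductivity.Theorems.KLProgrammeKLRegimeTwoVolumeTowerFamStepDecay
import Summits.HubbardSuperconductivity.HubbardSuperconductivity.Theorems.KLProgrammeKLRegimeTwoVolumeTowerStepCovFlowData
import Summits.HubbardSuperconductivity.HubbardSuperconductivity.Theorems.KLProgrammeKLRegimeTwoVolumeSliceFrameDefect
import Summits.HubbardSuperconductivity.HubbardSuperconductivity.Theorems.KLProgrammeKLRegimeEngineSymbolThresholds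
import Summits.HubbardSuperconductivity.HubbardSuperconductivity.Theorems.KLProgrammeKLRegimeEngineThresholdBridges
import Summits.HubbardSuperconductivity.HubbardSuperconductivity.Theorems.KLProgrammeKLRegimeEngineE4ScaleDoor
import Summits.HubbardSuperconductivity.HubbardSuperconductivity.Theorems.KLProgrammeKLRegimeSplitTwoLegReadJetsStruct
import Summits.HubbardSuperconductivity.HubbardSuperconductivity.Theorems.KLProgrammeKLRegimeAlphaWtFlowDeep
import Summits.HubbardSuperconductivity.HubbardSuperconductivity.Theorems.KLProgrammeKLRegimeVolumeLimitV11HinstDoors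
import Summits.HubbardSuperconductivity.HubbardSuperconductivity.Theorems.KLProgrammeKLRegimeTwoVolumeTowerDefs

/-!
# Route `KLProgramme` — crux K3, VL child (stmt-HubbardSuperconductivity-20440): THE STEP-COVARIANCE FRAME MISMATCH OF THE TWO VOLUMES (rows and columns,
# steps `1 ≤ j < n_β`) IS A THEOREM UNDER THE TOWER — the bulk of the atom `HmisCov`
# (seat hubbard-kl-k3c4-p1 g17; suppliers: p3 g16's #23 step lemmas `covStep_decay_le` (…TowerCovStepDecay) and `famStep_decay_le` (…TowerFamStepDecay) for two
# admissible frames with piece jets at depth `4^i`, k3c4-p2 g11's two-volume increment data `incrementData_twoVolume_of_towerV17F2'` (…TwoVolumeSliceFrameDefect),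
# p3's `norm_iteratedFDeriv_three_frameLevel_klFlowFrameU_le`, the symbol-layer thresholds `klEngC₃3_le_symbolC₃` / `klEngU₀3_le_symbolU₀`)

`klStepCov V M β μ K k = S(F̃_k[K])ᵀ C^K_{(Λ_{k+2},Λ_{k+1}]} S(F̃_k[K])`.  For `k = m+1 ≥ 1` and the two flow frames `K_L`, `K_{bL}` (top index `n_β+1`):
`klStepCov[K_{bL}] − klStepCov[K_L] = S_oᵀ(C^{K_{bL}} − C^{K_L})S_o − (S_oᵀ C^{K_{bL}} S_o − S_nᵀ C^{K_{bL}} S_n)` (`o = K_L`, `n = K_{bL}`): the COVARIANCE piece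
and the FAMILY piece of p3's #23 telescope step at `j := 2` (slice `(Λ_{m+3}, Λ_{m+2}]`), read at the FIXED depth `i₀ = n_β + 2m + 8` with the VOLUME-DEPENDENT
amplitude `G₀(L) = c_*·16^{i₀}/L` (`c_*` from the tower's increment jets, all four orders `O(1/L)`), so both pieces are `≤ 𝒦·G₀(L)·(M/β)/(Λ_{m+3}²·4^{i₀}) = O(1/L)`
uniformly in `(b, M)`; plain rows `≤` `klScaleWt`-weighted rows (`one_le_klScaleWt`).
* §1 `klStepCov_sub_eq_cov_sub_fam` (the matrix identity), `stepCov_mismatch_rows_le` (one step, all regime data explicit);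
* §2 **`hmisCovRowsPos_of_towerP`** — for every `(G, P, Q, R)` with `R.WF2`: `c ≤ klEngC₃3 P R`, `U ≤ min (klEngU₀3 P R c) (1/(Gfr₃+1))`; under `TowerP …`:
  `∃ cR cC : ℕ → ℕ → ℝ` (`0 ≤ · ≤ 1`, `→ 0`), `∃ L₂ M₂`, at every instance the rows `≤ cR j L / ε_M` and columns `≤ cC j L / ε_M` of
  `klStepCov (bL) M β μ K_{bL} j − klStepCov (bL) M β μ K_L j` for all `1 ≤ j < n_β` — the rows/columns conjuncts of `HmisCov` away from `j = 0`.
What remains of `HmisCov` after this file: the entry sups `sE` (all `j`) and the scale-`0` rows/columns (`j = 0`).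

Proofs only; no definition; nothing asserts HmisCov, any stub, K3, VL or superconductivity.  [cite: BenfattoGiulianiMastropietro2006, §2.8 (2.81), §3 (3.2)–(3.8)]
-/

noncomputable section

namespace Summit.HubbardSuperconductivity.HubbardSuperconductivity.Theorems.TwoVolumeSource

set_option linter.dupNamespace false -- summit = problem name (single-conjunct summit), D-0017

open Finset Filter Topology Literature.MathematicalPhysics.QuantumLattice GrassmannAlgebra Literature.Probability.LatticeModels
  Literature.Probability.LatticeModels.BattleFederbush Literature.MathematicalPhysics.QuantumLattice.BandSectorCounting
open Summit.HubbardSuperconductivity.HubbardSuperconductivity.Theorems.TwoPointAssembly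
open Summit.HubbardSuperconductivity.HubbardSuperconductivity.Theorems.KLRegimeSplit
open Summit.HubbardSuperconductivity.HubbardSuperconductivity.Theorems.KLProgrammeLegKernels
open Summit.HubbardSuperconductivity.HubbardSuperconductivity.Theorems.EngineV8
open Summit.HubbardSuperconductivity.HubbardSuperconductivity.Theorems.TwoVolumeDefect
open Summit.HubbardSuperconductivity.HubbardSuperconductivity.Theorems.TorusFourierL2
open Summit.HubbardSuperconductivity.HubbardSuperconductivity.Theorems.PerturbedFermiCurve
open Summit.HubbardSuperconductivity.HubbardSuperconductivity.Theorems.DispersionFlow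
open scoped Real

/-! ## §1 One step, all data explicit -/

section Step

variable {V M : ℕ} [NeZero V] [NeZero M]

omit [NeZero M] in
/-- **The step-covariance frame mismatch = covariance piece − family piece.** [folklore] -/
theorem klStepCov_sub_eq_cov_sub_fam (β μ : ℝ) (Ko Kn : TrigPolyC4v) (m : ℕ) :
    klStepCov V M β μ Kn (m + 1) - klStepCov V M β μ Ko (m + 1) =
      (sectorSubMatrix V M β (bgmFatMultiplier V M klE0 β (nambuXiCT V μ Ko) (m + 1))).transpose *
          (hubbardCovSliceCT V M β μ 0 Kn (klScale klE0 (m + 1 + 2)) (klScale klE0 (m + 2)) -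
            hubbardCovSliceCT V M β μ 0 Ko (klScale klE0 (m + 1 + 2)) (klScale klE0 (m + 2))) *
          sectorSubMatrix V M β (bgmFatMultiplier V M klE0 β (nambuXiCT V μ Ko) (m + 1)) -
        ((sectorSubMatrix V M β (bgmFatMultiplier V M klE0 β (nambuXiCT V μ Ko) (m + 1))).transpose *
              hubbardCovSliceCT V M β μ 0 Kn (klScale klE0 (m + 1 + 2)) (klScale klE0 (m + 2)) *
            sectorSubMatrix V M β (bgmFatMultiplier V M klE0 β (nambuXiCT V μ Ko) (m + 1)) -
          (sectorSubMatrix V M β (bgmFatMultiplier V M klE0 β (nambuXiCT V μ Kn) (m + 1))).transpose *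
              hubbardCovSliceCT V M β μ 0 Kn (klScale klE0 (m + 1 + 2)) (klScale klE0 (m + 2)) *
            sectorSubMatrix V M β (bgmFatMultiplier V M klE0 β (nambuXiCT V μ Kn) (m + 1))) := by
  simp only [klStepCov, show m + 1 + 2 = m + 3 from rfl, show m + 1 + 1 = m + 2 from rfl, Matrix.mul_sub, Matrix.sub_mul]
  abel

omit [NeZero M] in
/-- **ONE STEP OF THE STEP-COVARIANCE MISMATCH** (`k = m+1`): plain rows and columns of `klStepCov[K_n] − klStepCov[K_o]` from p3's covariance and family
pieces at depth `4^i` and amplitude `G₀`. [cite: BenfattoGiulianiMastropietro2006, §2.8 (2.81), §3 (3.2)–(3.8)] -/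
theorem stepCov_mismatch_rows_le {β μ : ℝ} {Ko Kn : TrigPolyC4v} {m nw : ℕ} {Bc Bf : ℝ}
    (hcov : (∀ Y : SpaceTimeIdx V M × SectorLeg (sectorCount (m + 1)), ∑ Y' : SpaceTimeIdx V M × SectorLeg (sectorCount (m + 1)),
        ‖((sectorSubMatrix V M β (bgmFatMultiplier V M klE0 β (nambuXiCT V μ Ko) (m + 1))).transpose *
            (hubbardCovSliceCT V M β μ 0 Kn (klScale klE0 (m + 1 + 2)) (klScale klE0 (m + 2)) - hubbardCovSliceCT V M β μ 0 Ko (klScale klE0 (m + 1 + 2)) (klScale klE0 (m + 2))) *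
            sectorSubMatrix V M β (bgmFatMultiplier V M klE0 β (nambuXiCT V μ Ko) (m + 1))) Y Y'‖ * EngineV8.klScaleWt V M β nw {EngineV8.latticeLegPos (2 * (2 * M)) Y, EngineV8.latticeLegPos (2 * (2 * M)) Y'} ≤ Bc) ∧
      (∀ Y' : SpaceTimeIdx V M × SectorLeg (sectorCount (m + 1)), ∑ Y : SpaceTimeIdx V M × SectorLeg (sectorCount (m + 1)),
        ‖((sectorSubMatrix V M β (bgmFatMultiplier V M klE0 β (nambuXiCT V μ Ko) (m + 1))).transpose *
            (hubbardCovSliceCT V M β μ 0 Kn (klScale klE0 (m + 1 + 2)) (klScale klE0 (m + 2)) - hubbardCovSliceCT V M β μ 0 Ko (klScale klE0 (m + 1 + 2)) (klScale klE0 (m + 2))) *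
            sectorSubMatrix V M β (bgmFatMultiplier V M klE0 β (nambuXiCT V μ Ko) (m + 1))) Y Y'‖ * EngineV8.klScaleWt V M β nw {EngineV8.latticeLegPos (2 * (2 * M)) Y, EngineV8.latticeLegPos (2 * (2 * M)) Y'} ≤ Bc))
    (hfam : (∀ Y : SpaceTimeIdx V M × SectorLeg (sectorCount (m + 1)), ∑ Y' : SpaceTimeIdx V M × SectorLeg (sectorCount (m + 1)),
        ‖((sectorSubMatrix V M β (bgmFatMultiplier V M klE0 β (nambuXiCT V μ Ko) (m + 1))).transpose * hubbardCovSliceCT V M β μ 0 Kn (klScale klE0 (m + 1 + 2)) (klScale klE0 (m + 2)) *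
              sectorSubMatrix V M β (bgmFatMultiplier V M klE0 β (nambuXiCT V μ Ko) (m + 1)) -
            (sectorSubMatrix V M β (bgmFatMultiplier V M klE0 β (nambuXiCT V μ Kn) (m + 1))).transpose * hubbardCovSliceCT V M β μ 0 Kn (klScale klE0 (m + 1 + 2)) (klScale klE0 (m + 2)) *
              sectorSubMatrix V M β (bgmFatMultiplier V M klE0 β (nambuXiCT V μ Kn) (m + 1))) Y Y'‖ * EngineV8.klScaleWt V M β nw {EngineV8.latticeLegPos (2 * (2 * M)) Y, EngineV8.latticeLegPos (2 * (2 * M)) Y'} ≤ Bf) ∧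
      (∀ Y' : SpaceTimeIdx V M × SectorLeg (sectorCount (m + 1)), ∑ Y : SpaceTimeIdx V M × SectorLeg (sectorCount (m + 1)),
        ‖((sectorSubMatrix V M β (bgmFatMultiplier V M klE0 β (nambuXiCT V μ Ko) (m + 1))).transpose * hubbardCovSliceCT V M β μ 0 Kn (klScale klE0 (m + 1 + 2)) (klScale klE0 (m + 2)) *
              sectorSubMatrix V M β (bgmFatMultiplier V M klE0 β (nambuXiCT V μ Ko) (m + 1)) -
            (sectorSubMatrix V M β (bgmFatMultiplier V M klE0 β (nambuXiCT V μ Kn) (m + 1))).transpose * hubbardCovSliceCT V M β μ 0 Kn (klScale klE0 (m + 1 + 2)) (klScale klE0 (m + 2)) *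
              sectorSubMatrix V M β (bgmFatMultiplier V M klE0 β (nambuXiCT V μ Kn) (m + 1))) Y Y'‖ * EngineV8.klScaleWt V M β nw {EngineV8.latticeLegPos (2 * (2 * M)) Y, EngineV8.latticeLegPos (2 * (2 * M)) Y'} ≤ Bf)) :
    (∀ x, ∑ y, ‖(klStepCov V M β μ Kn (m + 1) - klStepCov V M β μ Ko (m + 1)) x y‖ ≤ Bc + Bf) ∧
    (∀ y, ∑ x, ‖(klStepCov V M β μ Kn (m + 1) - klStepCov V M β μ Ko (m + 1)) x y‖ ≤ Bc + Bf) := by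
  classical
  obtain ⟨hcr, hcc⟩ := hcov
  obtain ⟨hfr, hfc⟩ := hfam
  rw [klStepCov_sub_eq_cov_sub_fam]
  set Cv := (sectorSubMatrix V M β (bgmFatMultiplier V M klE0 β (nambuXiCT V μ Ko) (m + 1))).transpose *
      (hubbardCovSliceCT V M β μ 0 Kn (klScale klE0 (m + 1 + 2)) (klScale klE0 (m + 2)) - hubbardCovSliceCT V M β μ 0 Ko (klScale klE0 (m + 1 + 2)) (klScale klE0 (m + 2))) *
      sectorSubMatrix V M β (bgmFatMultiplier V M klE0 β (nambuXiCT V μ Ko) (m + 1)) with hCv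
  set Fm := (sectorSubMatrix V M β (bgmFatMultiplier V M klE0 β (nambuXiCT V μ Ko) (m + 1))).transpose * hubbardCovSliceCT V M β μ 0 Kn (klScale klE0 (m + 1 + 2)) (klScale klE0 (m + 2)) *
        sectorSubMatrix V M β (bgmFatMultiplier V M klE0 β (nambuXiCT V μ Ko) (m + 1)) -
      (sectorSubMatrix V M β (bgmFatMultiplier V M klE0 β (nambuXiCT V μ Kn) (m + 1))).transpose * hubbardCovSliceCT V M β μ 0 Kn (klScale klE0 (m + 1 + 2)) (klScale klE0 (m + 2)) *
        sectorSubMatrix V M β (bgmFatMultiplier V M klE0 β (nambuXiCT V μ Kn) (m + 1)) with hFm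
  -- drop the weights (`klScaleWt ≥ 1`)
  have hw : ∀ (A : Matrix (SpaceTimeIdx V M × SectorLeg (sectorCount (m + 1))) (SpaceTimeIdx V M × SectorLeg (sectorCount (m + 1))) ℂ) (Y Y' : _),
      ‖A Y Y'‖ ≤ ‖A Y Y'‖ * EngineV8.klScaleWt V M β nw {EngineV8.latticeLegPos (2 * (2 * M)) Y, EngineV8.latticeLegPos (2 * (2 * M)) Y'} :=
    fun A Y Y' => le_mul_of_one_le_right (norm_nonneg _) (EngineV8.one_le_klScaleWt V M β nw _)
  refine ⟨fun x => ?_, fun y => ?_⟩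
  · calc ∑ y, ‖(Cv - Fm) x y‖ ≤ ∑ y, (‖Cv x y‖ + ‖Fm x y‖) := sum_le_sum fun y _ => by rw [Matrix.sub_apply]; exact norm_sub_le _ _
      _ = ∑ y, ‖Cv x y‖ + ∑ y, ‖Fm x y‖ := sum_add_distrib
      _ ≤ Bc + Bf := add_le_add ((sum_le_sum fun y _ => hw Cv x y).trans (hcr x)) ((sum_le_sum fun y _ => hw Fm x y).trans (hfr x))
  · calc ∑ x, ‖(Cv - Fm) x y‖ ≤ ∑ x, (‖Cv x y‖ + ‖Fm x y‖) := sum_le_sum fun x _ => by rw [Matrix.sub_apply]; exact norm_sub_le _ _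
      _ = ∑ x, ‖Cv x y‖ + ∑ x, ‖Fm x y‖ := sum_add_distrib
      _ ≤ Bc + Bf := add_le_add ((sum_le_sum fun x _ => hw Cv x y).trans (hcc y)) ((sum_le_sum fun x _ => hw Fm x y).trans (hfc y))

end Step

/-! ## §2 The step-covariance mismatch of the two volumes under the tower (steps `1 ≤ j < n_β`) -/

set_option maxHeartbeats 3200000 in -- long regime bookkeeping, two 40-binder step lemmas per step
/-- **THE STEP-COVARIANCE FRAME MISMATCH (ROWS / COLUMNS, `1 ≤ j < n_β`) IS A THEOREM UNDER THE TOWER** (see the module docstring).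
[cite: BenfattoGiulianiMastropietro2006, §2.8 (2.81), §3 (3.2)–(3.8)] -/
theorem hmisCovRowsPos_of_towerP (G : GeoConsts) (P : SplitConsts) (Q : EngConsts) (R : RenConsts) (hR2 : R.WF2) :
    ∃ c₇ : ℝ, 0 < c₇ ∧ ∀ c : ℝ, 0 < c → c ≤ c₇ → ∃ U₇ : ℝ, 0 < U₇ ∧
      ∀ μ ∈ klWindowC, ∀ U : ℝ, 0 < U → U ≤ U₇ → ∀ β : ℝ, klBetaMin ≤ β → β ≤ Real.exp (c / U ^ 2) →
        ∀ (K : TrigPolyC4v) (Lstar : ℕ) (Mstar : ℕ → ℕ), TowerP klPredsV17F2 G P Q R β U μ K Lstar Mstar →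
        ∃ (cR cC : ℕ → ℕ → ℝ), (∀ j L, 0 ≤ cR j L ∧ 0 ≤ cC j L ∧ cR j L ≤ 1 ∧ cC j L ≤ 1) ∧
          (∀ j, Tendsto (cR j) atTop (𝓝 0) ∧ Tendsto (cC j) atTop (𝓝 0)) ∧
        ∃ L₂ : ℕ, ∃ M₂ : ℕ → ℕ → ℕ, ∀ (L b M : ℕ) [NeZero L] [NeZero (b * L)] [NeZero M], L₂ ≤ L → M₂ L b ≤ M →
          (∀ j, 1 ≤ j → j < nScales β → ∀ x, ∑ y, ‖(klStepCov (b * L) M β μ (klFlowFrameU (b * L) M β U μ (nScales β + 1)) j -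
              klStepCov (b * L) M β μ (klFlowFrameU L M β U μ (nScales β + 1)) j) x y‖ ≤ cR j L / imagTimeWeight β M) ∧
          (∀ j, 1 ≤ j → j < nScales β → ∀ y, ∑ x, ‖(klStepCov (b * L) M β μ (klFlowFrameU (b * L) M β U μ (nScales β + 1)) j -
              klStepCov (b * L) M β μ (klFlowFrameU L M β U μ (nScales β + 1)) j) x y‖ ≤ cC j L / imagTimeWeight β M) := by
  classical
  have ha : (-4 : ℝ) < -(6 / 5) := by norm_num
  have hab : (-(6 / 5) : ℝ) ≤ -(1 / 10) := by norm_num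
  have hb : (-(1 / 10) : ℝ) < 0 := by norm_num
  -- the two absolute step lemmas at slice offset `j := 2`
  obtain ⟨𝒦c, ρc, h𝒦c, hρc, hcov⟩ := covStep_decay_le ha hab hb 2
  obtain ⟨𝒦f, ρf, h𝒦f, hρf, hfam⟩ := famStep_decay_le ha hab hb 2
  have hρ : 0 < min ρc ρf := lt_min hρc hρf
  obtain ⟨N, hN⟩ := exists_nat_gt (1 / (32 * min ρc ρf))
  have hN0 : (0 : ℝ) < N := lt_trans (by positivity) hN
  have hRj : ∀ j, 0 ≤ R.Gfr j := gfr_nonneg_of_wf2 hR2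
  refine ⟨klEngC₃3 P R, klEngC₃3_pos P R, fun c hc hc3 => ⟨min (klEngU₀3 P R c) (1 / (R.Gfr 3 + 1)),
    lt_min (klEngU₀3_pos P R c) (by have := hRj 3; positivity), fun μ hμ U hU hUle β hβmin hβc K Lstar Mstar hT => ?_⟩⟩
  have hβ0 : 0 < β := KLRegimeSplit.pos_of_klBetaMin_le hβmin
  have hU3 : U ≤ klEngU₀3 P R c := hUle.trans (min_le_left _ _)
  have hUG : U ≤ 1 / (R.Gfr 3 + 1) := hUle.trans (min_le_right _ _)
  have hcle := hc3.trans (klEngC₃3_le_symbolC₃ ha hab hb P hRj)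
  have hUsym := hU3.trans (klEngU₀3_le_symbolU₀ ha hab hb P hRj c)
  have hU1 : U ≤ 1 := hUsym.trans (min_le_left _ _)
  have hGU : R.Gfr 3 * U ≤ 1 := by
    have h3 := hRj 3
    calc R.Gfr 3 * U ≤ R.Gfr 3 * (1 / (R.Gfr 3 + 1)) := mul_le_mul_of_nonneg_left hUG h3
      _ = R.Gfr 3 / (R.Gfr 3 + 1) := by ring
      _ ≤ 1 := by rw [div_le_one (by positivity)]; linarith
  have hn1 : 1 ≤ nScales β + 1 := Nat.le_add_left 1 _
  -- the tower's increment numerators (orders `0 … 3`) and one majorant `cst ≥ 1`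
  set Ac : ℕ → ℝ := fun r => ∑ m ∈ range (nScales β + 1), 4 * (2 * klFlowDeg m + 1) * (1 + 4 * klFlowDeg m) ^ r * Q.CL β m with hAc
  set cst : ℝ := |Ac 0| + |Ac 1| + |Ac 2| + |Ac 3| + 1 with hcst
  have hcst1 : 1 ≤ cst := by have := abs_nonneg (Ac 0); have := abs_nonneg (Ac 1); have := abs_nonneg (Ac 2); have := abs_nonneg (Ac 3); linarith
  have hcst0 : 0 < cst := lt_of_lt_of_le one_pos hcst1
  have hAj : ∀ j ≤ 3, Ac j ≤ cst := by
    intro j hj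
    have h0 := le_abs_self (Ac 0); have h1 := le_abs_self (Ac 1); have h2 := le_abs_self (Ac 2); have h3 := le_abs_self (Ac 3)
    have a0 := abs_nonneg (Ac 0); have a1 := abs_nonneg (Ac 1); have a2 := abs_nonneg (Ac 2); have a3 := abs_nonneg (Ac 3)
    interval_cases j <;> simp only [hcst] <;> linarith
  -- depth, amplitude and rate per step `k = m + 1`
  set i₀ : ℕ → ℕ := fun m => nScales β + 2 * m + 8 with hi₀
  set imax : ℕ := 3 * nScales β + 8 with himax
  set Gm : ℕ → ℕ → ℝ := fun m L => cst * (16 : ℝ) ^ (i₀ m) / L with hGm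
  set cRate : ℕ → ℕ → ℝ := fun m L => (𝒦c + 𝒦f) * Gm m L / (2 * klScale klE0 (m + 3) ^ 2 * (4 : ℝ) ^ (i₀ m)) with hcRate
  have hΛpos : ∀ n, 0 < klScale klE0 n := fun n => klth_klScale_pos n
  have hcRate0 : ∀ m L, 0 ≤ cRate m L := fun m L => by
    simp only [hcRate, hGm]; have := hΛpos (m + 3); positivity
  -- the caps' threshold
  set Λmin : ℝ := klScale klE0 (nScales β + 3) with hΛmin
  have hΛmin0 : 0 < Λmin := hΛpos _
  set Lcap : ℕ := ⌈cst * (16 : ℝ) ^ imax⌉₊ + ⌈(𝒦c + 𝒦f) * cst * (16 : ℝ) ^ imax / (2 * Λmin ^ 2)⌉₊ + 1 with hLcap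
  refine ⟨fun j L => Nat.casesOn j 0 (fun m => min 1 (cRate m L)), fun j L => Nat.casesOn j 0 (fun m => min 1 (cRate m L)), fun j L => ?_, fun j => ?_,
    max (max Lstar (klEngL₃ β U)) Lcap,
    fun L b => max (max (Mstar L) (Mstar (b * L))) (max (klEngM₃ β U (b * L)) (max (Q.M0 β L) (Q.M0 β (b * L)))),
    fun L b M _ _ _ hL hM => ?_⟩
  · cases j with
    | zero => exact ⟨le_rfl, le_rfl, zero_le_one, zero_le_one⟩
    | succ m => exact ⟨le_min zero_le_one (hcRate0 m L), le_min zero_le_one (hcRate0 m L), min_le_left _ _, min_le_left _ _⟩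
  · cases j with
    | zero => exact ⟨tendsto_const_nhds, tendsto_const_nhds⟩
    | succ m =>
      have hlim : Tendsto (fun L : ℕ => min 1 (cRate m L)) atTop (𝓝 0) := by
        have h := (tendsto_const_div_atTop_nhds_zero_nat (cst * (16 : ℝ) ^ (i₀ m))).const_mul
          ((𝒦c + 𝒦f) / (2 * klScale klE0 (m + 3) ^ 2 * (4 : ℝ) ^ (i₀ m)))
        rw [mul_zero] at h
        refine squeeze_zero (fun L => le_min zero_le_one (hcRate0 m L)) (fun L => (min_le_right _ _).trans (le_of_eq ?_)) h
        simp only [hcRate, hGm]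
        ring
      exact ⟨hlim, hlim⟩
  -- one instance
  dsimp only at hL hM
  have hLs : Lstar ≤ L := by omega
  have hL3 : klEngL₃ β U ≤ L := by omega
  have hLc : Lcap ≤ L := by omega
  have hMs : Mstar L ≤ M := by omega
  have hMsb : Mstar (b * L) ≤ M := by omega
  have hM3b : klEngM₃ β U (b * L) ≤ M := by omega
  have hMQ : Q.M0 β L ≤ M := by omega
  have hMQb : Q.M0 β (b * L) ≤ M := by omega
  have hb1 : 1 ≤ b := Nat.pos_of_ne_zero fun hb => NeZero.ne (b * L) (by rw [hb, Nat.zero_mul])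
  have hLbL : L ≤ b * L := Nat.le_mul_of_pos_left L hb1
  have hL3b : klEngL₃ β U ≤ b * L := hL3.trans hLbL
  have hL0 : (0 : ℝ) < L := Nat.cast_pos.2 (Nat.pos_of_ne_zero (NeZero.ne L))
  have hM0 : (0 : ℝ) < M := Nat.cast_pos.2 (Nat.pos_of_ne_zero (NeZero.ne M))
  have hLcapR : (Lcap : ℝ) ≤ L := by exact_mod_cast hLc
  have hLcap1 : cst * (16 : ℝ) ^ imax ≤ L := by
    have h1 : cst * (16 : ℝ) ^ imax ≤ ⌈cst * (16 : ℝ) ^ imax⌉₊ := Nat.le_ceil _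
    have h2 : ((⌈cst * (16 : ℝ) ^ imax⌉₊ : ℕ) : ℝ) ≤ Lcap := by simp only [hLcap]; push_cast; linarith [Nat.cast_nonneg (α := ℝ) ⌈(𝒦c + 𝒦f) * cst * (16 : ℝ) ^ imax / (2 * Λmin ^ 2)⌉₊]
    linarith
  have hLcap2 : (𝒦c + 𝒦f) * cst * (16 : ℝ) ^ imax / (2 * Λmin ^ 2) ≤ L := by
    have h1 : (𝒦c + 𝒦f) * cst * (16 : ℝ) ^ imax / (2 * Λmin ^ 2) ≤ ⌈(𝒦c + 𝒦f) * cst * (16 : ℝ) ^ imax / (2 * Λmin ^ 2)⌉₊ := Nat.le_ceil _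
    have h2 : ((⌈(𝒦c + 𝒦f) * cst * (16 : ℝ) ^ imax / (2 * Λmin ^ 2)⌉₊ : ℕ) : ℝ) ≤ Lcap := by
      simp only [hLcap]; push_cast; linarith [Nat.cast_nonneg (α := ℝ) ⌈cst * (16 : ℝ) ^ imax⌉₊]
    linarith
  -- the flow frames, their third jets and the level's third jets, both volumes
  have hhL := histP_top_of_towerP hT hLs hMs
  have hhb := histP_top_of_towerP hT (hLs.trans hLbL) hMsb
  have hK : FrameOK R U (nScales β) μ (klFlowFrameU L M β U μ (nScales β + 1)) := frameOK_klFlowFrameU_of_histP_le hR2 hn1 le_rfl le_rfl hhL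
  have hKb : FrameOK R U (nScales β) μ (klFlowFrameU (b * L) M β U μ (nScales β + 1)) := frameOK_klFlowFrameU_of_histP_le hR2 hn1 le_rfl le_rfl hhb
  have hJL : ∀ m' < nScales β + 1, FlowPieceJetsAt L M β U μ R m' := fun m' hm' =>
    ((histP_klPredsV17F2_iff L M G P Q R β U μ 0 (nScales β + 1)).1 hhL m' hm').2.1.2.1
  have hJb : ∀ m' < nScales β + 1, FlowPieceJetsAt (b * L) M β U μ R m' := fun m' hm' =>
    ((histP_klPredsV17F2_iff (b * L) M G P Q R β U μ 0 (nScales β + 1)).1 hhb m' hm').2.1.2.1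
  have hS3L := (frameShift_high_sizes_of_frameOK hRj hK).1
  have hS3b := (frameShift_high_sizes_of_frameOK hRj hKb).1
  have hE3L := norm_iteratedFDeriv_three_frameLevel_klFlowFrameU_le (L := L) (M := M) (μ := μ) hRj hJL
  have hE3b := norm_iteratedFDeriv_three_frameLevel_klFlowFrameU_le (L := b * L) (M := M) (μ := μ) hRj hJb
  -- the increment jets of the two frames (second frame the fine one)
  obtain ⟨hΔ0, hΔ1, hΔ2, hΔ3⟩ := incrementData_twoVolume_of_towerV17F2' hμ hT hLs hLbL hMs hMQ hMsb hMQb (n := nScales β + 1) le_rfl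
  -- the lattice thresholds on the fine lattice
  have hLβ : β ^ 2 ≤ ((b * L : ℕ) : ℝ) := sq_le_of_klEngL₃_le hL3b
  have hMβ : β ≤ (M : ℝ) := le_of_klEngM₃_le hβmin hL3b hM3b
  -- per step `k = m + 1 < n_β`
  have hstep : ∀ m : ℕ, m + 2 ≤ nScales β →
      (∀ x, ∑ y, ‖(klStepCov (b * L) M β μ (klFlowFrameU (b * L) M β U μ (nScales β + 1)) (m + 1) -
          klStepCov (b * L) M β μ (klFlowFrameU L M β U μ (nScales β + 1)) (m + 1)) x y‖ ≤ cRate m L / imagTimeWeight β M) ∧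
      (∀ y, ∑ x, ‖(klStepCov (b * L) M β μ (klFlowFrameU (b * L) M β U μ (nScales β + 1)) (m + 1) -
          klStepCov (b * L) M β μ (klFlowFrameU L M β U μ (nScales β + 1)) (m + 1)) x y‖ ≤ cRate m L / imagTimeWeight β M) ∧
      cRate m L ≤ 1 := by
    intro m hm
    have hi₀m : i₀ m = nScales β + 2 * m + 8 := rfl
    have him : i₀ m ≤ imax := by simp only [hi₀, himax]; omega
    have h4pos : (0 : ℝ) < (4 : ℝ) ^ (i₀ m) := by positivity
    have h16pos : (0 : ℝ) < (16 : ℝ) ^ (i₀ m) := by positivity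
    have h41 : (1 : ℝ) ≤ (4 : ℝ) ^ (i₀ m) := one_le_pow₀ (by norm_num)
    have h16sq : ((4 : ℝ) ^ (i₀ m)) ^ 2 = (16 : ℝ) ^ (i₀ m) := by rw [← pow_mul, show (16 : ℝ) = 4 ^ 2 by norm_num, ← pow_mul, mul_comm]
    have h16le : (16 : ℝ) ^ (i₀ m) ≤ (16 : ℝ) ^ imax := pow_le_pow_right₀ (by norm_num) him
    -- the amplitude `G = cst·16^{i₀}/L ∈ (0, 1]`
    have hG0 : 0 < Gm m L := by simp only [hGm]; positivity
    have hG1 : Gm m L ≤ 1 := by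
      simp only [hGm]
      rw [div_le_one hL0]
      exact le_trans (mul_le_mul_of_nonneg_left h16le hcst0.le) hLcap1
    -- the increment jets in the `(G, 4^{i₀})` normalisation
    have eG : Gm m L / ((4 : ℝ) ^ (i₀ m)) ^ 2 = cst / L := by
      rw [h16sq]; simp only [hGm]; field_simp
    have hj0 : ∀ p : Momentum, |frameLevel μ (klFlowFrameU (b * L) M β U μ (nScales β + 1)) p - frameLevel μ (klFlowFrameU L M β U μ (nScales β + 1)) p| ≤
        Gm m L / ((4 : ℝ) ^ (i₀ m)) ^ 2 := fun p => (hΔ0 p).trans (by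
      rw [eG]; exact div_le_div_of_nonneg_right (hAj 0 (by norm_num)) hL0.le)
    have hj1 : ∀ p : Momentum, ‖fderiv ℝ (fun q : Momentum => frameLevel μ (klFlowFrameU (b * L) M β U μ (nScales β + 1)) q -
        frameLevel μ (klFlowFrameU L M β U μ (nScales β + 1)) q) p‖ ≤ Gm m L / (4 : ℝ) ^ (i₀ m) := fun p => (hΔ1 p).trans (by
      simp only [hGm]
      rw [div_div, le_div_iff₀ (by positivity)]
      have h1 : Ac 1 / L * (L * (4 : ℝ) ^ (i₀ m)) = Ac 1 * (4 : ℝ) ^ (i₀ m) := by field_simp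
      rw [h1]
      have h2 : Ac 1 * (4 : ℝ) ^ (i₀ m) ≤ cst * (4 : ℝ) ^ (i₀ m) := mul_le_mul_of_nonneg_right (hAj 1 (by norm_num)) h4pos.le
      have h3 : cst * (4 : ℝ) ^ (i₀ m) ≤ cst * (16 : ℝ) ^ (i₀ m) := by
        refine mul_le_mul_of_nonneg_left ?_ hcst0.le
        rw [← h16sq]; nlinarith
      linarith)
    have hj2 : ∀ p : Momentum, ‖iteratedFDeriv ℝ 2 (fun q : Momentum => frameLevel μ (klFlowFrameU (b * L) M β U μ (nScales β + 1)) q -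
        frameLevel μ (klFlowFrameU L M β U μ (nScales β + 1)) q) p‖ ≤ Gm m L := fun p => (hΔ2 p).trans (by
      simp only [hGm]
      refine div_le_div_of_nonneg_right ?_ hL0.le
      have h16one : (1 : ℝ) ≤ (16 : ℝ) ^ (i₀ m) := one_le_pow₀ (by norm_num)
      nlinarith [hAj 2 (by norm_num), hcst0])
    have hj3 : ∀ p : Momentum, ‖iteratedFDeriv ℝ 3 (fun q : Momentum => frameLevel μ (klFlowFrameU (b * L) M β U μ (nScales β + 1)) q -
        frameLevel μ (klFlowFrameU L M β U μ (nScales β + 1)) q) p‖ ≤ Gm m L * (4 : ℝ) ^ (i₀ m) := fun p => (hΔ3 p).trans (by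
      simp only [hGm]
      have h16one : (1 : ℝ) ≤ (16 : ℝ) ^ (i₀ m) := one_le_pow₀ (by norm_num)
      have hA3 := hAj 3 (by norm_num)
      rw [div_mul_eq_mul_div]
      refine div_le_div_of_nonneg_right ?_ hL0.le
      nlinarith [mul_nonneg hcst0.le (sub_nonneg.2 h16one), mul_nonneg (mul_nonneg hcst0.le h16pos.le) (sub_nonneg.2 h41)])
    -- the frames' third jets at depth `i₀`
    have hpow : (4 : ℝ) ^ (nScales β + 1) ≤ (4 : ℝ) ^ (i₀ m) := pow_le_pow_right₀ (by norm_num) (by simp only [hi₀]; omega)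
    have hpow' : (4 : ℝ) ^ (i₀ m) ≤ (4 : ℝ) ^ (i₀ m + 1) := pow_le_pow_right₀ (by norm_num) (Nat.le_succ _)
    have hG3 : 0 ≤ R.Gfr 3 * U ^ 2 := by have := hRj 3; positivity
    have h43 : (4 : ℝ) ^ (nScales β + 1) / 3 ≤ (4 : ℝ) ^ (i₀ m + 1) / 3 := div_le_div_of_nonneg_right (hpow.trans hpow') (by norm_num)
    have hS3o : ∀ p : Momentum, ‖iteratedFDeriv ℝ 3 (frameShift (klFlowFrameU L M β U μ (nScales β + 1))) p‖ ≤ R.Gfr 3 * U ^ 2 * ((4 : ℝ) ^ (i₀ m) / 3) :=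
      fun p => (hS3L p).trans (by gcongr)
    have hS3n : ∀ p : Momentum, ‖iteratedFDeriv ℝ 3 (frameShift (klFlowFrameU (b * L) M β U μ (nScales β + 1))) p‖ ≤ R.Gfr 3 * U ^ 2 * ((4 : ℝ) ^ (i₀ m + 1) / 3) :=
      fun p => (hS3b p).trans (mul_le_mul_of_nonneg_left h43 hG3)
    have hE3o : ∀ p : Momentum, ‖iteratedFDeriv ℝ 3 (frameLevel μ (klFlowFrameU L M β U μ (nScales β + 1))) p‖ ≤ 64 + R.Gfr 3 * U ^ 2 * ((4 : ℝ) ^ (i₀ m) / 3) :=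
      fun p => (hE3L p).trans (by gcongr)
    have hE3n : ∀ p : Momentum, ‖iteratedFDeriv ℝ 3 (frameLevel μ (klFlowFrameU (b * L) M β U μ (nScales β + 1))) p‖ ≤ 64 + R.Gfr 3 * U ^ 2 * ((4 : ℝ) ^ (i₀ m + 1) / 3) :=
      fun p => (hE3b p).trans (by have := mul_le_mul_of_nonneg_left h43 hG3; linarith)
    -- depth and weight scale
    have hdepth : (4 : ℝ) ^ (2 + 4) * (16 : ℝ) ^ (m + 1) ≤ (4 : ℝ) ^ (i₀ m) := by
      rw [show (16 : ℝ) = 4 ^ 2 by norm_num, ← pow_mul, ← pow_add]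
      exact pow_le_pow_right₀ (by norm_num) (by simp only [hi₀]; omega)
    have hnw : klScale klE0 (i₀ m + N) * (4 : ℝ) ^ (i₀ m) ≤ min ρc ρf := by
      have hN1 : (1 : ℝ) ≤ N := by
        have : 1 ≤ N := Nat.one_le_iff_ne_zero.2 (by rintro rfl; simp at hN0)
        exact_mod_cast this
      have h4N : (N : ℝ) ≤ (4 : ℝ) ^ N := by exact_mod_cast (Nat.lt_pow_self (by norm_num : 1 < 4)).le
      have e : klScale klE0 (i₀ m + N) * (4 : ℝ) ^ (i₀ m) = (1 / 32) / (4 : ℝ) ^ N := by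
        rw [klScale, klE0, pow_add]; field_simp
      rw [e]
      have h1 : (1 / 32 : ℝ) / (4 : ℝ) ^ N ≤ (1 / 32) / N := div_le_div_of_nonneg_left (by norm_num) hN0 h4N
      have h2 : (1 / 32 : ℝ) / N < min ρc ρf := by
        rw [div_lt_iff₀ hN0]
        have := (div_lt_iff₀ (by positivity : (0 : ℝ) < 32 * min ρc ρf)).1 hN
        linarith
      linarith
    have hnwc : klScale klE0 (i₀ m + N) * (4 : ℝ) ^ (i₀ m) ≤ ρc := hnw.trans (min_le_left _ _)
    have hnwf : klScale klE0 (i₀ m + N) * (4 : ℝ) ^ (i₀ m) ≤ ρf := hnw.trans (min_le_right _ _)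
    have hmN : m + 1 + 2 ≤ nScales β + 1 := by omega
    -- the two pieces
    have hC := hcov R hRj c U hc hcle hU hUsym hGU β hβmin hβc μ hμ (b * L) M hLβ hMβ _ _ (i₀ m) hK hKb hS3o hS3n hE3o hE3n (Gm m L) hG0 hG1
      hj0 hj1 hj2 hj3 m hmN hdepth (i₀ m + N) hnwc
    have hF := hfam R hRj c U hc hcle hU hUsym hGU β hβmin hβc μ hμ (b * L) M hLβ hMβ _ _ (i₀ m) hK hKb hS3o hS3n hE3o hE3n (Gm m L) hG0 hG1
      hj0 hj1 hj2 hj3 m hmN hdepth (i₀ m + N) hnwf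
    obtain ⟨hr, hc'⟩ := stepCov_mismatch_rows_le hC hF
    -- the bound in the `ε_M` currency
    have hid : 𝒦c * Gm m L * ((M : ℝ) / β) / (klScale klE0 (m + 1 + 2) ^ 2 * (4 : ℝ) ^ (i₀ m)) +
        𝒦f * Gm m L * ((M : ℝ) / β) / (klScale klE0 (m + 1 + 2) ^ 2 * (4 : ℝ) ^ (i₀ m)) = cRate m L / imagTimeWeight β M := by
      have hΛ := hΛpos (m + 3)
      simp only [hcRate, show m + 1 + 2 = m + 3 from rfl, imagTimeWeight]
      field_simp
    refine ⟨fun x => (hr x).trans (le_of_eq hid), fun y => (hc' y).trans (le_of_eq hid), ?_⟩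
    -- the cap
    have hΛm : Λmin ≤ klScale klE0 (m + 3) := by
      simp only [hΛmin, klScale]
      refine mul_le_mul_of_nonneg_left (inv_anti₀ (by positivity) (pow_le_pow_right₀ (by norm_num) (by omega))) (by norm_num [klE0])
    have hK0 : 0 ≤ 𝒦c + 𝒦f := add_nonneg h𝒦c h𝒦f
    calc cRate m L = (𝒦c + 𝒦f) * (cst * (16 : ℝ) ^ (i₀ m)) / (2 * klScale klE0 (m + 3) ^ 2 * (4 : ℝ) ^ (i₀ m)) / L := by
          simp only [hcRate, hGm]; field_simp
      _ ≤ (𝒦c + 𝒦f) * (cst * (16 : ℝ) ^ imax) / (2 * Λmin ^ 2 * 1) / L := by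
          gcongr
      _ = (𝒦c + 𝒦f) * cst * (16 : ℝ) ^ imax / (2 * Λmin ^ 2) / L := by ring
      _ ≤ 1 := by rw [div_le_one hL0]; exact hLcap2
  refine ⟨fun j hj1 hjn x => ?_, fun j hj1 hjn y => ?_⟩
  · obtain ⟨m, rfl⟩ : ∃ m, j = m + 1 := ⟨j - 1, by omega⟩
    obtain ⟨hr, -, hcap⟩ := hstep m (by omega)
    show _ ≤ min 1 (cRate m L) / imagTimeWeight β M
    rw [min_eq_right hcap]
    exact hr x
  · obtain ⟨m, rfl⟩ : ∃ m, j = m + 1 := ⟨j - 1, by omega⟩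
    obtain ⟨-, hc', hcap⟩ := hstep m (by omega)
    show _ ≤ min 1 (cRate m L) / imagTimeWeight β M
    rw [min_eq_right hcap]
    exact hc' y

end Summit.HubbardSuperconductivity.HubbardSuperconductivity.Theorems.TwoVolumeSource

end
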